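import Summits.QuantumFields.YangMills.Theorems.BalabanUVNodesPortS1P0CMobius

/-!
# NODE O port — `stub_P0C` (the guarded P0-ℂ letter `P0HolExtAtRecordGL`), brick A′: THE MÖBIUS SUPPLIER INTERFACE ON THE INTEGER WINDOWS
# (memo `Cruxes/PortRecordRepresentationS1/Lines/pta_residueW-stub_P0C-hand.md` §2 (P1), §3 R7; companion of ✓`…PortS1P0CMobius`)

Porter hand `hand-27930-P0C` (g0), `--supports stmt-QuantumFields-27930 --as helper`; count-neutral.  [I] = [Balaban1987RG1].

WHY.  Clause (P1) of `K0RecordFormatNames.P0CarrierClauses` asks an INTEGER twin `TZY X̂ f` of the carrier pieces — ONE formula on `ℤ⁴` windows for all member volumes ([I] (1.21)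
«we take a limit … T^{(j+1)} ↗ Z^d. This limit exists by the localized representation (1.7)»), supported in the `L·Mc`-blocks of `X̂` (Z-supp), indexed by NON-EMPTY FACE-CONNECTED
cube sets (Z-dom), window-local at cube side `L^{k+1}·Mc` (Z-loc), blockwise covariant under the pulled-back (1.10) action (Z-cov).  As on the torus side (✓`…PortS1P0CMobius` §2),
the pieces are the Möbius inverse of a family of X̂-LOCALIZED integer kernels `X̂ ↦ TZ_X̂`, now over the poset of non-empty face-connected finite subsets of `ℤ⁴` (extended by `0`
elsewhere, so (Z-dom) holds by construction), and (Z-supp)(Z-loc)(Z-cov) TRANSFER from the family to the pieces.  What does not transfer (the supplier's rows): the (Z-bridge) to the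
torus pieces off the wrap class (PTA-1's cover kit, ✓`coverAt_injOn_blockSites_intCubes`) and every estimate.

WHAT THIS FILE PROVES (sorry-free): `P0CMob.downSetsSubtype` (the enumerator for a decidable sub-poset of `Finset α`); `P0CIntDom`, `P0CIntIdx`, `p0cIntDown`, ★ `p0cIntPiece`
(+ `_of_not` = (Z-dom), `_of_mem`), ★ `sum_p0cIntPiece_subset` (the integer partial-sum identity), transfers ★ `p0cIntPiece_support` (Z-supp) ∕ ★ `p0cIntPiece_isLocal` (Z-loc, as
`IntFormula.IsLocal` entry by entry, verbatim) ∕ ★ `p0cIntPiece_cov` (Z-cov through `AdZ`, verbatim).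

HONEST FRAMING.  Finite Möbius bookkeeping in ed.13 currency; NO estimate; nothing of Bałaban asserted, ported or discharged; `stub_P0C` NOT closed; ⟨27930⟩ OPEN; NODE O 0∕1;
COUNT 8∕28 · K 1∕4 UNMOVED; finite `𝕋⁴_{L^K}` at fixed ε — NOT continuum ∕ OS ∕ Clay; **the Yang–Mills mass gap is NOT proved by any of this.**  No `sorry`, no `instance`, no
`notation`; standard axioms.
-/

noncomputable section

open scoped BigOperators
open Finset

namespace Summit.QuantumFields.YangMills.Theorems.BalabanUVNodesPortS1

namespace P0CMob

/-- The `Subtype` enumerator: for a decidable predicate `p` on finite sets, `below Y := (Y.1.ssubsets).subtype p`, `val := Subtype.val`. [folklore] -/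
def downSetsSubtype {α : Type*} [DecidableEq α] (p : Finset α → Prop) [DecidablePred p] : DownSets (fun Y : {s : Finset α // p s} => Y.1) :=
  ⟨fun Y => (Y.1.ssubsets).subtype p, fun _ _ => by rw [Finset.mem_subtype, Finset.mem_ssubsets]⟩

end P0CMob

section IntRecord

open Summit.QuantumFields.YangMills.Theorems.K0RecordFormatNames
open Literature.MathematicalPhysics.QuantumFieldTheory.Balaban1983to89
open Literature.MathematicalPhysics.QuantumFieldTheory.Balaban1983to89.Node00
open Literature.MathematicalPhysics.QuantumLattice (blockMap)

/-- The index poset of the integer pieces: non-empty face-connected finite sets of cube indices of `ℤ⁴` ((Z-dom) of `P0CarrierClauses`). [cite: Balaban1987RG1, p.257 (class 𝐃_j), (1.21) p.264] -/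
abbrev P0CIntDom : Type := {Xh : Finset (Fin 4 → ℤ) // Xh.Nonempty ∧ B13ScaleTransfer.FaceConnected Xh}

/-- The index type of the integer kernels: (integer bond) × colour. [cite: Balaban1987RG1, (1.21) p.264 (bookkeeping)] -/
abbrev P0CIntIdx : Type := ((Fin 4 → ℤ) × Fin 4) × Fin 3

open scoped Classical in
/-- The strict-down-set enumerator of the integer poset. [folklore] -/
def p0cIntDown : P0CMob.DownSets (fun Y : P0CIntDom => Y.1) :=
  P0CMob.downSetsSubtype fun Xh : Finset (Fin 4 → ℤ) => Xh.Nonempty ∧ B13ScaleTransfer.FaceConnected Xh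

open scoped Classical in
/-- **THE INTEGER PIECES of a family of window-localized integer kernels** `TZ : P0CIntDom → (IntBondCfg → kernels)`: the Möbius inverse over the face-connected poset, extended by
`0` to all finite sets (so (Z-dom) holds by construction) — the candidate `TZY` of `P0CarrierClauses`. [cite: Balaban1987RG1, (1.7) p.261, (1.21) p.264] -/
def p0cIntPiece (TZ : P0CIntDom → IntBondCfg → P0CIntIdx → P0CIntIdx → ℂ) : Finset (Fin 4 → ℤ) → IntBondCfg → P0CIntIdx → P0CIntIdx → ℂ :=
  fun Xh => if h : Xh.Nonempty ∧ B13ScaleTransfer.FaceConnected Xh then p0cIntDown.mobius TZ ⟨Xh, h⟩ else 0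

variable (TZ : P0CIntDom → IntBondCfg → P0CIntIdx → P0CIntIdx → ℂ)

/-- **(Z-dom) BY CONSTRUCTION**: the integer pieces vanish off the non-empty face-connected sets. [cite: Balaban1987RG1, p.257 (bookkeeping)] -/
theorem p0cIntPiece_of_not {Xh : Finset (Fin 4 → ℤ)} (h : ¬ (Xh.Nonempty ∧ B13ScaleTransfer.FaceConnected Xh)) (f : IntBondCfg) (i j : P0CIntIdx) :
    p0cIntPiece TZ Xh f i j = 0 := by
  classical
  simp only [p0cIntPiece, dif_neg h]
  rfl

/-- On the poset the integer piece IS the Möbius piece. [folklore] -/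
theorem p0cIntPiece_of_mem (X : P0CIntDom) : p0cIntPiece TZ X.1 = p0cIntDown.mobius TZ X := by
  classical
  simp only [p0cIntPiece, dif_pos X.2]

open scoped Classical in
/-- ★ **THE INTEGER PARTIAL-SUM IDENTITY**: `Σ_{Y ∈ (X̂.powerset).subtype p} piece TZ Y.1 f i j = TZ X̂ f i j` over the non-empty face-connected `Y ⊆ X̂`.
[cite: Balaban1987RG1, (1.7) p.261, (1.21) p.264] -/
theorem sum_p0cIntPiece_subset (X : P0CIntDom) (f : IntBondCfg) (i j : P0CIntIdx) :
    ∑ Y ∈ (X.1.powerset).subtype (fun Xh : Finset (Fin 4 → ℤ) => Xh.Nonempty ∧ B13ScaleTransfer.FaceConnected Xh), p0cIntPiece TZ Y.1 f i j = TZ X f i j := by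
  classical
  have h := p0cIntDown.sum_mobius_of_mem_iff (fun _ _ h => Subtype.ext h) TZ X
    (s := (X.1.powerset).subtype (fun Xh : Finset (Fin 4 → ℤ) => Xh.Nonempty ∧ B13ScaleTransfer.FaceConnected Xh))
    (fun Y => by rw [Finset.mem_subtype, Finset.mem_powerset])
  have h' := congrFun (congrFun (congrFun h f) i) j
  rw [Finset.sum_apply, Finset.sum_apply, Finset.sum_apply] at h'
  rw [← h']
  exact Finset.sum_congr rfl fun Y _ => by rw [p0cIntPiece_of_mem]

/-- **(Z-supp) TRANSFERS**: support of the kernels in the `s`-blocks of the indexing set passes from the family to the pieces (blocks of `Y ⊆ X̂` lie in `X̂`).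
[cite: Balaban1987RG1, (1.7) p.261 (bookkeeping)] -/
theorem p0cIntPiece_support (s : ℕ)
    (hT : ∀ (X : P0CIntDom) (f : IntBondCfg) (bi bj : (Fin 4 → ℤ) × Fin 4) (a a' : Fin 3),
      (blockMap s bi.1 ∉ X.1 ∨ blockMap s bj.1 ∉ X.1) → TZ X f (bi, a) (bj, a') = 0)
    (Xh : Finset (Fin 4 → ℤ)) (f : IntBondCfg) (bi bj : (Fin 4 → ℤ) × Fin 4) (a a' : Fin 3) (hij : blockMap s bi.1 ∉ Xh ∨ blockMap s bj.1 ∉ Xh) :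
    p0cIntPiece TZ Xh f (bi, a) (bj, a') = 0 := by
  classical
  by_cases hX : Xh.Nonempty ∧ B13ScaleTransfer.FaceConnected Xh
  · let p : P0CIntDom → (IntBondCfg → P0CIntIdx → P0CIntIdx → ℂ) → Prop :=
      fun Y m => ∀ f bi bj a a', (blockMap s bi.1 ∉ Y.1 ∨ blockMap s bj.1 ∉ Y.1) → m f (bi, a) (bj, a') = 0
    have key : ∀ Y, p Y (p0cIntDown.mobius TZ Y) := by
      refine p0cIntDown.mobius_induction p ?_ ?_ ?_ ?_ hT
      · intro Y Y' m hss hm f bi bj a a' h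
        exact hm f bi bj a a' (h.imp (fun h1 h2 => h1 (hss.subset h2)) (fun h1 h2 => h1 (hss.subset h2)))
      · intro Y f bi bj a a' _; rfl
      · intro Y u v hu hv f bi bj a a' h; simp only [Pi.add_apply, hu f bi bj a a' h, hv f bi bj a a' h, add_zero]
      · intro Y u v hu hv f bi bj a a' h; simp only [Pi.sub_apply, hu f bi bj a a' h, hv f bi bj a a' h, sub_zero]
    have e := p0cIntPiece_of_mem TZ ⟨Xh, hX⟩
    rw [e]
    exact key ⟨Xh, hX⟩ f bi bj a a' hij
  · exact p0cIntPiece_of_not TZ hX f _ _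

/-- **(Z-loc) TRANSFERS**: window-locality at cube side `s` (`IntFormula.IsLocal s`, entry by entry) passes from the family — read as «`TZ X̂ f` depends on `f` only at the integer bonds
with both ends in `⋃_{a ∈ X̂} cubeExt s a 0`» — to the pieces (the window of `Y ⊆ X̂` lies in the window of `X̂`). [cite: Balaban1987RG1, (1.7) p.261] -/
theorem p0cIntPiece_isLocal (s : ℕ)
    (hT : ∀ (X : P0CIntDom) (f f' : IntBondCfg),
      (∀ zμ : (Fin 4 → ℤ) × Fin 4, zμ.1 ∈ (⋃ a ∈ X.1, B14.Eq213MaximalDomains.cubeExt s a 0) →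
        Function.update zμ.1 zμ.2 (zμ.1 zμ.2 + 1) ∈ (⋃ a ∈ X.1, B14.Eq213MaximalDomains.cubeExt s a 0) → f zμ = f' zμ) → TZ X f = TZ X f')
    (i j : P0CIntIdx) : IntFormula.IsLocal s fun Xh f => p0cIntPiece TZ Xh f i j := by
  classical
  intro Xh f f' hff'
  by_cases hX : Xh.Nonempty ∧ B13ScaleTransfer.FaceConnected Xh
  · let p : P0CIntDom → (IntBondCfg → P0CIntIdx → P0CIntIdx → ℂ) → Prop :=
      fun Y m => ∀ f f' : IntBondCfg,
        (∀ zμ : (Fin 4 → ℤ) × Fin 4, zμ.1 ∈ (⋃ a ∈ Y.1, B14.Eq213MaximalDomains.cubeExt s a 0) →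
          Function.update zμ.1 zμ.2 (zμ.1 zμ.2 + 1) ∈ (⋃ a ∈ Y.1, B14.Eq213MaximalDomains.cubeExt s a 0) → f zμ = f' zμ) → m f = m f'
    have key : ∀ Y, p Y (p0cIntDown.mobius TZ Y) := by
      refine p0cIntDown.mobius_induction p ?_ ?_ ?_ ?_ hT
      · intro Y Y' m hss hm f f' h
        have hsub : (⋃ a ∈ Y'.1, B14.Eq213MaximalDomains.cubeExt s a 0) ⊆ (⋃ a ∈ Y.1, B14.Eq213MaximalDomains.cubeExt s a 0) :=
          Set.biUnion_subset_biUnion_left fun a ha => hss.subset ha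
        exact hm f f' fun zμ h1 h2 => h zμ (hsub h1) (hsub h2)
      · intro Y f f' _; rfl
      · intro Y u v hu hv f f' h; simp only [Pi.add_apply, hu f f' h, hv f f' h]
      · intro Y u v hu hv f f' h; simp only [Pi.sub_apply, hu f f' h, hv f f' h]
    have e := p0cIntPiece_of_mem TZ ⟨Xh, hX⟩
    show p0cIntPiece TZ Xh f i j = p0cIntPiece TZ Xh f' i j
    rw [e, key ⟨Xh, hX⟩ f f' hff']
  · show p0cIntPiece TZ Xh f i j = p0cIntPiece TZ Xh f' i j
    rw [p0cIntPiece_of_not TZ hX, p0cIntPiece_of_not TZ hX]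

/-- **(Z-cov) TRANSFERS**: blockwise covariance under the pulled-back (1.10) action of `Gc`-valued `û` through `3 × 3` bond blocks `AdZ û b` passes from the family to the pieces
(conjugation is linear). [cite: Balaban1987RG1, (1.10) p.262, (1.19) p.263] -/
theorem p0cIntPiece_cov (AdZ : ((Fin 4 → ℤ) → (MatA 2)ˣ) → (Fin 4 → ℤ) × Fin 4 → Matrix (Fin 3) (Fin 3) ℂ)
    (hT : ∀ (û : (Fin 4 → ℤ) → (MatA 2)ˣ), (∀ z, û z ∈ (B12RegularSpaces111SpecialUnitary.suModel 2).Gc) →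
      ∀ (X : P0CIntDom) (f : IntBondCfg) (bi bj : (Fin 4 → ℤ) × Fin 4),
        (Matrix.of fun a a' : Fin 3 => TZ X (intGaugeAct û f) (bi, a) (bj, a')) =
          AdZ û bi * (Matrix.of fun a a' : Fin 3 => TZ X f (bi, a) (bj, a')) * (AdZ û bj)⁻¹)
    (û : (Fin 4 → ℤ) → (MatA 2)ˣ) (hû : ∀ z, û z ∈ (B12RegularSpaces111SpecialUnitary.suModel 2).Gc)
    (Xh : Finset (Fin 4 → ℤ)) (f : IntBondCfg) (bi bj : (Fin 4 → ℤ) × Fin 4) :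
    (Matrix.of fun a a' : Fin 3 => p0cIntPiece TZ Xh (intGaugeAct û f) (bi, a) (bj, a')) =
      AdZ û bi * (Matrix.of fun a a' : Fin 3 => p0cIntPiece TZ Xh f (bi, a) (bj, a')) * (AdZ û bj)⁻¹ := by
  classical
  by_cases hX : Xh.Nonempty ∧ B13ScaleTransfer.FaceConnected Xh
  · let p : P0CIntDom → (IntBondCfg → P0CIntIdx → P0CIntIdx → ℂ) → Prop :=
      fun _ m => ∀ (f : IntBondCfg) (bi bj : (Fin 4 → ℤ) × Fin 4),
        (Matrix.of fun a a' : Fin 3 => m (intGaugeAct û f) (bi, a) (bj, a')) = AdZ û bi * (Matrix.of fun a a' : Fin 3 => m f (bi, a) (bj, a')) * (AdZ û bj)⁻¹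
    have key : ∀ Y, p Y (p0cIntDown.mobius TZ Y) := by
      refine p0cIntDown.mobius_induction p (fun _ _ _ _ h => h) ?_ ?_ ?_ (fun Y f bi bj => hT û hû Y f bi bj)
      · intro Y f bi bj
        have h0 : (Matrix.of fun a a' : Fin 3 => (0 : IntBondCfg → P0CIntIdx → P0CIntIdx → ℂ) f (bi, a) (bj, a')) = 0 := rfl
        have h0' : (Matrix.of fun a a' : Fin 3 => (0 : IntBondCfg → P0CIntIdx → P0CIntIdx → ℂ) (intGaugeAct û f) (bi, a) (bj, a')) = 0 := rfl
        rw [h0, h0', Matrix.mul_zero, Matrix.zero_mul]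
      · intro Y u v hu hv f bi bj
        have e1 : (Matrix.of fun a a' : Fin 3 => (u + v) (intGaugeAct û f) (bi, a) (bj, a')) =
            (Matrix.of fun a a' : Fin 3 => u (intGaugeAct û f) (bi, a) (bj, a')) + Matrix.of fun a a' : Fin 3 => v (intGaugeAct û f) (bi, a) (bj, a') := rfl
        have e2 : (Matrix.of fun a a' : Fin 3 => (u + v) f (bi, a) (bj, a')) =
            (Matrix.of fun a a' : Fin 3 => u f (bi, a) (bj, a')) + Matrix.of fun a a' : Fin 3 => v f (bi, a) (bj, a') := rfl
        rw [e1, e2, hu f bi bj, hv f bi bj, Matrix.mul_add, Matrix.add_mul]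
      · intro Y u v hu hv f bi bj
        have e1 : (Matrix.of fun a a' : Fin 3 => (u - v) (intGaugeAct û f) (bi, a) (bj, a')) =
            (Matrix.of fun a a' : Fin 3 => u (intGaugeAct û f) (bi, a) (bj, a')) - Matrix.of fun a a' : Fin 3 => v (intGaugeAct û f) (bi, a) (bj, a') := rfl
        have e2 : (Matrix.of fun a a' : Fin 3 => (u - v) f (bi, a) (bj, a')) =
            (Matrix.of fun a a' : Fin 3 => u f (bi, a) (bj, a')) - Matrix.of fun a a' : Fin 3 => v f (bi, a) (bj, a') := rfl
        rw [e1, e2, hu f bi bj, hv f bi bj, Matrix.mul_sub, Matrix.sub_mul]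
    have e := p0cIntPiece_of_mem TZ ⟨Xh, hX⟩
    simp only [e]
    exact key ⟨Xh, hX⟩ f bi bj
  · have h0 : (Matrix.of fun a a' : Fin 3 => p0cIntPiece TZ Xh (intGaugeAct û f) (bi, a) (bj, a')) = 0 := by
      ext a a'; simp only [Matrix.of_apply, p0cIntPiece_of_not TZ hX, Matrix.zero_apply]
    have h1 : (Matrix.of fun a a' : Fin 3 => p0cIntPiece TZ Xh f (bi, a) (bj, a')) = 0 := by
      ext a a'; simp only [Matrix.of_apply, p0cIntPiece_of_not TZ hX, Matrix.zero_apply]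
    rw [h0, h1, Matrix.mul_zero, Matrix.zero_mul]

end IntRecord

end Summit.QuantumFields.YangMills.Theorems.BalabanUVNodesPortS1

end
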